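import Literature.MathematicalPhysics.QuantumFieldTheory.ConformalBootstrap3D.PointKernelK34L505Data
import Literature.MathematicalPhysics.QuantumFieldTheory.ConformalBootstrap3D.PointKernelK34L505Segs
import Literature.MathematicalPhysics.QuantumFieldTheory.ConformalBootstrap3D.PointKernelParts

/-!
# K34L505 certificate, kernel part file P57: one-cell head segments 126, 149, 150, 151 in level ranges

The head cells whose kernel evaluation exceeds one `decide` are one-cell segments of `hsegsK34L505`; each is
checked by `PCert.hPartSideOK` (side conditions) and `PCert.hPartOK` per level range `[n_lo, n_lo + count)`
against an integer claim, the claims summing to `≥ 0` (`PointKernel.partsOK`); soundness is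
`PCert.hParts_sound` (`PointKernelParts`).  The part files are mutually independent (each imports only
the data file); the ranges of one cell may span several of them, and the per-cell conclusions
`hparts_i` / `hcell_i` of those cells are assembled in `PointKernelK34L505.lean`.
Estimated kernel time 244 s.
-/

set_option maxRecDepth 100000
set_option maxHeartbeats 0

namespace Literature.MathematicalPhysics.QuantumFieldTheory.ConformalBootstrap3D.PointKernelK34L505

open Literature.MathematicalPhysics.QuantumFieldTheory.ConformalBootstrap3D.PointKernel

/-- levels `[0, 33)` of segment 126: partial lower sum `≥` claim. [folklore] -/
theorem part_126_0 : certK34L505.hPartOK (PCert.segAt hsegsK34L505 126) JHK34L505 0 33 (0) = true := by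
  decide +kernel

/-- one-cell segment 149 (row 8, cell `[9, 577/64]`, chord, `n_F = 30`,
1 level ranges): side conditions. [folklore] -/
theorem pside_149 : certK34L505.hPartSideOK (PCert.segAt hsegsK34L505 149) JHK34L505 = true := by
  decide +kernel

/-- its level ranges `(n_lo, count, claim)`. [folklore] -/
def partsK34L505_149 : List (ℕ × ℕ × ℤ) := [(0, 31, 0)]

/-- the ranges tile `[0, n_F]` and the claims sum to `≥ 0`. [folklore] -/
theorem pcov_149 : PointKernel.partsOK 30 partsK34L505_149 = true := by
  decide +kernel

/-- levels `[0, 31)` of segment 149: partial lower sum `≥` claim. [folklore] -/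
theorem part_149_0 : certK34L505.hPartOK (PCert.segAt hsegsK34L505 149) JHK34L505 0 31 (0) = true := by
  decide +kernel

/-- one-cell segment 150 (row 8, cell `[577/64, 289/32]`, chord, `n_F = 30`,
1 level ranges): side conditions. [folklore] -/
theorem pside_150 : certK34L505.hPartSideOK (PCert.segAt hsegsK34L505 150) JHK34L505 = true := by
  decide +kernel

/-- its level ranges `(n_lo, count, claim)`. [folklore] -/
def partsK34L505_150 : List (ℕ × ℕ × ℤ) := [(0, 31, 0)]

/-- the ranges tile `[0, n_F]` and the claims sum to `≥ 0`. [folklore] -/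
theorem pcov_150 : PointKernel.partsOK 30 partsK34L505_150 = true := by
  decide +kernel

/-- levels `[0, 31)` of segment 150: partial lower sum `≥` claim. [folklore] -/
theorem part_150_0 : certK34L505.hPartOK (PCert.segAt hsegsK34L505 150) JHK34L505 0 31 (0) = true := by
  decide +kernel

/-- one-cell segment 151 (row 8, cell `[289/32, 145/16]`, chord, `n_F = 38`,
2 level ranges): side conditions. [folklore] -/
theorem pside_151 : certK34L505.hPartSideOK (PCert.segAt hsegsK34L505 151) JHK34L505 = true := by
  decide +kernel

/-- its level ranges `(n_lo, count, claim)`. [folklore] -/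
def partsK34L505_151 : List (ℕ × ℕ × ℤ) := [(0, 31, -22956269596452037531649856464226417213), (31, 8, 22956269596452037531649856464226417213)]

/-- the ranges tile `[0, n_F]` and the claims sum to `≥ 0`. [folklore] -/
theorem pcov_151 : PointKernel.partsOK 38 partsK34L505_151 = true := by
  decide +kernel

/-- levels `[0, 31)` of segment 151: partial lower sum `≥` claim. [folklore] -/
theorem part_151_0 : certK34L505.hPartOK (PCert.segAt hsegsK34L505 151) JHK34L505 0 31 (-22956269596452037531649856464226417213) = true := by
  decide +kernel

end Literature.MathematicalPhysics.QuantumFieldTheory.ConformalBootstrap3D.PointKernelK34L505
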